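import Literature.Computability.QuantumComplexity.JonesInBQP
import Literature.Computability.QuantumComplexity.PathModelRepresentation
import Literature.Computability.Cryptography.QuantumTuringMachine
import Literature.Computability.Cryptography.QubitRegisterProofs
import Literature.Computability.Cryptography.QubitRegisterCliffordTProofs
import Literature.Computability.QuantumComplexity.ReversibleCliffordT
import Literature.Computability.QuantumComplexity.CliffordTInverse
import HarnessLib

/-!
# AJL, `jonesApproxProblem ∈ PromiseBQP`: the decomposition (proof architecture and shells)

Topic `Literature/Computability/QuantumComplexity`; sibling of `JonesInBQP.lean`, whose named fact
`ajl_jonesApproxProblem_mem_PromiseBQP` (`jonesApproxProblem ∈ PromiseBQP`: the threshold promise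
problem for `|V_{b^{pl}}(e^{2πi/5})| / d^{n/2-1}` is decided by a polynomial-time UNIFORM
(`TM2`) oracle-free Clifford+`T` circuit family with error `≤ 1/3`) is an XL statement. This file
fixes the proof architecture, after D. Aharonov, V. Jones, Z. Landau, *A polynomial quantum
algorithm for approximating the Jones polynomial*, Algorithmica 55 (2009) = arXiv:quant-ph/0511096
(held; arXiv numbering), §3, and vendors its complexity-theoretic shells as named facts:

1. **Linear algebra (PROVED, `PathModelRepresentation.lean`)**: the path-model generators
   `Φ_i` on `n`-bit strings (§3.1, eq. (3.1)), `Φ_iᵀ = Φ_i`, `Φ_i² = dΦ_i` (Claim 3.1), unitarity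
   of the crossing matrices `A^{±1}Φ_i + A^{∓1}1` and of `φ(b)` (Claims 2.2, 3.1, Cor. 3.1),
   Claim 3.8; and the named fact `ajl_thm32_matrixElement` (the identity of the proof of
   Thm. 3.2, `⟨α|φ(b)|α⟩ = ⟨b^{pl}⟩(A)/d^{n/2-1}`; its tree proof — link states and the
   loop-count recursion — is `PathModelLinkStates.lean` + `JonesLoopCount.lean`,
   `ajl_thm32_matrixElement_holds`), whence `ajlRatio 5 n b = |⟨α|φ(b)|α⟩| ≤ 1`: the YES/NO
   conditions of `jonesApproxProblem` are conditions on one diagonal entry of an explicit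
   unitary.
2. **AJL's algorithm in AJL's model (NAMED FACT `ajl_mem_PromiseBQPOver_ajlGateSet`, §3.2–§3.3,
   Claims 3.2, 3.3, Cor. 3.1, Thm. 3.2, with §2.1–§2.2)**: AJL work with arbitrary two-qubit
   gates ("we restrict ourselves to `k = 2` [-qubit gates]", App. 5) and a hybrid
   classical/quantum model ("standard that this model can be simulated efficiently by the
   standard quantum computation model", §2.1), and estimate `⟨α|φ(b)|α⟩` by Hadamard tests
   (§2.2) averaged over polynomially many runs (Chernoff–Hoeffding). In the tree's uniform-family
   model this is membership of `jonesApproxProblem` in `PromiseBQPOver ajlGateSet`, the promise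
   class over the FINITE gate set `ajlGateSet` = Clifford+`T` ∪ {controlled AJL crossing gate at
   `k = 5` and its inverse} (`ajlCrossingGate`: the crossing unitary `A Φ + A⁻¹ 1` acting
   locally on three consecutive vertex registers of the path in AJL's vertex-sequence basis
   `𝒱_{n,k}` of §2.12 — two qubits per vertex of `G_5 = {1,2,3,4}` — controlled on one more
   qubit for the Hadamard test; 7 wires). With this gate the circuit `Q(b)` of Cor. 3.1 is a
   direct transcription of the braid word, the Hadamard tests are exact, and no gate
   compilation is involved; what remains is the programmable layout (the circuit for input
   length `N` reads `n`, `b`, `θ`, `prec` from its input wires), the reversible classical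
   post-processing (average, modulus, comparison with `θ + 1/(2·prec)`), the Chernoff bound, and
   `TM2` uniformity of the layout.
3. **Gate-set independence of `PromiseBQP` (NAMED FACT `PromiseBQPOver_eq_PromiseBQP`;
   Bernstein–Vazirani 1997 §8, Dawson–Nielsen 2006 Thm. 1 = the Solovay–Kitaev algorithm,
   Watrous 2009 §III.1)**: for a finite, unitary, inverse-closed, placement-universal gate set
   with polynomial-time computable entries, `PromiseBQPOver G = PromiseBQP` — the promise-class
   form of the tree's `Literature.Computability.QuantumComplexity.BQPOver_eq_BQP` (`BQP.lean`, same hypotheses).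
4. **The hypotheses of 3 for `ajlGateSet`**: finiteness/encodability (instances below),
   unitarity (PROVED, `ajlGateSet_isUnitary_of cliffordT_isUnitary_holds`: `Φ_loc² = dΦ_loc` for
   the local generator as in `PathModelRepresentation.lean`, a controlled unitary is unitary),
   inverse-closedness (PROVED, `ajlGateSet_isInverseClosed`: `H² = S⁴ = T⁸ = CNOT² = 1` and the
   two controlled crossing gates are mutually inverse), universality from that of Clifford+`T`
   (PROVED reduction `ajlGateSet_isUniversal_of`; universality of Clifford+`T` itself is the
   named fact `Literature.Computability.QuantumComplexity.cliffordT_isUniversal` of `BQP.lean`), and polynomial-time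
   computability of the (algebraic) entries (NAMED FACT `ajlGateSet_polyTimeEntries`, Ko 1991).
5. **Assembly (PROVED, `ajl_jonesApproxProblem_mem_PromiseBQP_of_steps'`)**: S1 + S2 +
   universality of Clifford+`T` + S3 give `ajl_jonesApproxProblem_mem_PromiseBQP`.

## References

* D. Aharonov, V. Jones, Z. Landau, Algorithmica 55 (2009) 395–421; arXiv:quant-ph/0511096, §2.1,
  §2.2, §2.12, §3.1–§3.3 (Claims 3.1–3.3, Cor. 3.1, Thm. 3.2, Claim 3.8), App. 5
  [AharonovJonesLandau2009].
* E. Bernstein, U. Vazirani, *Quantum complexity theory*, SIAM J. Comput. 26 (1997), §8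
  [BernsteinVazirani1997].
* C. M. Dawson, M. A. Nielsen, *The Solovay–Kitaev algorithm*, QIC 6 (2006), Thm. 1 [DawsonNielsen2006].
* J. Watrous, *Quantum computational complexity* (2009), §III.1–III.2 [Watrous2009].
* K.-I. Ko, *Complexity theory of real functions* (1991), §2 [Ko1991].
-/

noncomputable section

open Matrix Complex Computability Literature.Computability.Complexity

namespace Literature.Computability.QuantumComplexity

/-! ### Promise-BQP over a gate set -/

/-- **`PromiseBQPOver G`**: promise problems decided with completeness `≥ 2/3` / soundness
`≤ 1/3` by a polynomial-time uniform, oracle-free family of circuits over the gate set `G`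
(nothing required off the promise); `PromiseBQP = PromiseBQPOver cliffordT`. The promise-class
analogue of `BQPOver`. [cite: Watrous2009, §III.2] -/
def PromiseBQPOver (G : Cryptography.QGateSet) [Encodable G.Op] : Set PromiseProblem :=
  {Q | ∃ F : Cryptography.QCircuitFamily G, F.IsOracleFree ∧ F.IsUniform ∧
    (∀ x ∈ Q.yes, 2 / 3 ≤ F.acceptProbOn 0 x) ∧ (∀ x ∈ Q.no, F.acceptProbOn 0 x ≤ 1 / 3)}

/-- `PromiseBQP` is `PromiseBQPOver cliffordT` (definitional). [cite: Watrous2009, §III.2] -/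
theorem PromiseBQPOver_cliffordT : PromiseBQPOver Cryptography.cliffordT = Cryptography.PromiseBQP := rfl

/-- **Gate-set independence of `PromiseBQP` (Solovay–Kitaev).** For a *finite* gate set `G`
whose gates are unitary with polynomial-time computable entries, which is inverse-closed and
universal at the placement level, `PromiseBQPOver G = PromiseBQP`: each gate of one set is
compiled by the Solovay–Kitaev algorithm into a word of length `polylog(1/δ)` over the other with
accuracy `δ = 1/poly`, uniformly because the entries are polynomial-time computable, and the
accumulated error is absorbed by error reduction; nothing in the argument refers to inputs off
the promise. Same hypotheses as the language-class statement `Literature.Computability.QuantumComplexity.BQPOver_eq_BQP`.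
[cite: BernsteinVazirani1997, §8] [cite: DawsonNielsen2006, Thm. 1] [cite: Watrous2009, §III.1] -/
def PromiseBQPOver_eq_PromiseBQP : Prop :=
  ∀ (G : Cryptography.QGateSet) [Finite G.Op] [Encodable G.Op] (_ : G.IsUnitary) (_ : G.IsUniversal)
    (_ : G.IsInverseClosed)
    (_ : ∀ (g : G.Op) (i j : Cryptography.QReg (G.arity g)), G.mat g i j ∈ Cryptography.polyTimeComputableComplex),
    PromiseBQPOver G = Cryptography.PromiseBQP

/-! ### The AJL crossing gate at `k = 5` in the vertex-sequence encoding, and the gate set -/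

/-- The vertex of `G_5 = {1, 2, 3, 4}` coded by two bits (`z - 1` in binary, high bit first).
[cite: AharonovJonesLandau2009, §2.12 (the basis `𝒱_{n,k}` of vertex sequences)] -/
def vertexOfBits (b₀ b₁ : Bool) : ℤ :=
  1 + 2 * (if b₀ then 1 else 0) + (if b₁ then 1 else 0)

/-- **The local path-model generator at `k = 5` on three consecutive vertex registers**
`(x_{j-1} | x_j | x_{j+1})` = wires `(0,1 | 2,3 | 4,5)`: the matrix `τ(E_j)` of AJL §2.12 in the
vertex-sequence basis, i.e. the `(q, p)` entry is `√(λ_{b} λ_{b'}) / λ_z` when `p` and `q` both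
read `(z, ·, z)` on the outer registers with middle vertices `b, b' ∈ {z - 1, z + 1}`, and `0`
otherwise (this is eq. (3.1) transported along "vertex sequence ↔ step sequence", Claim 3.1's
"natural isomorphism"; zero outside the walks). [cite: AharonovJonesLandau2009, §2.12 and §3.1 eq. (3.1)] -/
def ajlLocalPhi : Matrix (Cryptography.QReg 6) (Cryptography.QReg 6) ℝ :=
  Matrix.of fun q p =>
    if vertexOfBits (p 0) (p 1) = vertexOfBits (q 0) (q 1) ∧
        vertexOfBits (p 4) (p 5) = vertexOfBits (q 4) (q 5) ∧
        vertexOfBits (p 0) (p 1) = vertexOfBits (p 4) (p 5) ∧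
        (vertexOfBits (p 2) (p 3) = vertexOfBits (p 0) (p 1) + 1 ∨
          vertexOfBits (p 2) (p 3) = vertexOfBits (p 0) (p 1) - 1) ∧
        (vertexOfBits (q 2) (q 3) = vertexOfBits (p 0) (p 1) + 1 ∨
          vertexOfBits (q 2) (q 3) = vertexOfBits (p 0) (p 1) - 1) then
      Real.sqrt (ajlWeight 5 (vertexOfBits (p 2) (p 3)) * ajlWeight 5 (vertexOfBits (q 2) (q 3))) /
        ajlWeight 5 (vertexOfBits (p 0) (p 1))
    else 0

/-- The local crossing unitary `ρ_A(σ^{±1}) = A^{±1} Φ_loc + A^{∓1} 1` at `A = A_5 = i e^{-iπ/10}`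
on three vertex registers. [cite: AharonovJonesLandau2009, Def. 2.6, Def. 2.14 and Claim 3.2] -/
def ajlLocalCrossing (positive : Bool) : Matrix (Cryptography.QReg 6) (Cryptography.QReg 6) ℂ :=
  crossingWeight (ajlPoint 5) positive true • ajlLocalPhi.map ((↑) : ℝ → ℂ) +
    crossingWeight (ajlPoint 5) positive false • (1 : Matrix (Cryptography.QReg 6) (Cryptography.QReg 6) ℂ)

/-- The controlled version `|0⟩⟨0| ⊗ 1 + |1⟩⟨1| ⊗ U` of an `m`-qubit gate, control = wire `0`,
targets = wires `1, …, m`. (Nielsen–Chuang §4.3.) [folklore] -/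
def controlledGate {m : ℕ} (U : Matrix (Cryptography.QReg m) (Cryptography.QReg m) ℂ) :
    Matrix (Cryptography.QReg (m + 1)) (Cryptography.QReg (m + 1)) ℂ :=
  Matrix.of fun q p =>
    if q 0 = p 0 then
      (if p 0 = true then U (Fin.tail q) (Fin.tail p) else if Fin.tail q = Fin.tail p then 1 else 0)
    else 0

/-- **The controlled AJL crossing gate** (7 wires: control, then three vertex registers), the
gate applied letter by letter in the Hadamard test of Algorithm Approximate-Jones-Plat-Closure.
[cite: AharonovJonesLandau2009, §2.2 and §3.3 (Hadamard test of `Q(B)`), Cor. 3.1] -/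
def ajlCrossingGate (positive : Bool) : Matrix (Cryptography.QReg 7) (Cryptography.QReg 7) ℂ :=
  controlledGate (ajlLocalCrossing positive)

/-- The gate alphabet of `ajlGateSet`: a Clifford+`T` symbol or a signed crossing. [folklore] -/
abbrev AJLOp : Type := Cryptography.CliffordTOp ⊕ Bool

/-- **The AJL gate set at `k = 5`**: Clifford+`T` together with the controlled crossing gate and
its inverse (the controlled negative crossing), arity `7`. Finite; AJL's own model allows all
two-qubit gates (App. 5), over which these 7-qubit gates are exact words (Claim 3.2).
[cite: AharonovJonesLandau2009, Claim 3.2 and App. 5] -/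
def ajlGateSet : Cryptography.QGateSet where
  Op := AJLOp
  arity
    | .inl g => Cryptography.cliffordT.arity g
    | .inr _ => 7
  mat
    | .inl g => Cryptography.cliffordT.mat g
    | .inr positive => ajlCrossingGate positive

/-- The gate alphabet of `ajlGateSet` is encodable. [folklore] -/
instance instEncodableOpAjlGateSet : Encodable ajlGateSet.Op := inferInstanceAs (Encodable AJLOp)

/-- The gate alphabet of `ajlGateSet` is finite. [folklore] -/
instance instFiniteOpAjlGateSet : Finite ajlGateSet.Op := inferInstanceAs (Finite AJLOp)

/-! ### The shells as named facts -/

/-- **AJL §3 in AJL's model, made finite: `jonesApproxProblem ∈ PromiseBQPOver ajlGateSet`.**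
For input length `N`, a polynomial-time uniform oracle-free circuit over `ajlGateSet` reads the
instance `⟨n, b, θ_num, θ_den, prec⟩` from its input wires, prepares `|α⟩` in the vertex encoding
(`X = HS²H` gates), runs `poly(N)` independent exact Hadamard tests (§2.2) of
`Q(b) = φ(b)` — each letter `σ_i^{±1}` of `b` one controlled crossing gate on the registers
`x_i, x_{i+1}, x_{i+2}` (Claim 3.2, Cor. 3.1), selected by the input through classical reversible
control — for the real and the imaginary part, computes reversibly the empirical mean `r` and the
bit `[|r| ≥ θ + 1/(2·prec)]` onto wire `0`; by `ajl_thm32_matrixElement`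
(`|⟨α|φ(b)|α⟩| = ajlRatio 5 n b`) and the Chernoff–Hoeffding bound the YES-instances
(`ajlRatio ≥ θ + 1/prec`) are accepted and the NO-instances (`≤ θ`) rejected with probability
`≥ 2/3` (Claim 3.3, Thm. 3.2; `prec` is unary, so `poly(N)` repetitions suffice). The hybrid
classical/quantum bookkeeping is compiled into the circuit (§2.1). [cite: AharonovJonesLandau2009, §3.3, Claims 3.2–3.3, Cor. 3.1 and Thm. 3.2 (with §2.1–§2.2)] -/
def ajl_mem_PromiseBQPOver_ajlGateSet : Prop :=
  jonesApproxProblem ∈ PromiseBQPOver ajlGateSet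

/-- **The entries of the AJL gates are polynomial-time computable complex numbers**: they are
`0`, `1`, `±1/√2`, `i`, `e^{iπ/4}` (Clifford+`T`) and products of `A_5^{±1} = ∓i e^{∓iπ/10}`… with
`√(λ_b λ_{b'})/λ_z`, `λ_ℓ = sin(πℓ/5)` — algebraic numbers, whose binary expansions are
computable in polynomial time. [cite: Ko1991, §2 (Thm. 2.2: real algebraic numbers are polynomial-time computable)] [cite: BernsteinVazirani1997, §6] -/
def ajlGateSet_polyTimeEntries : Prop :=
  ∀ (g : ajlGateSet.Op) (i j : Cryptography.QReg (ajlGateSet.arity g)), ajlGateSet.mat g i j ∈ Cryptography.polyTimeComputableComplex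

/-! ### Proved reductions of the hypotheses on `ajlGateSet` -/

/-- Every Clifford+`T` placement is an `ajlGateSet` placement. [folklore] -/
theorem placements_cliffordT_subset (N : ℕ) : Cryptography.placements Cryptography.cliffordT N ⊆ Cryptography.placements ajlGateSet N := by
  rintro M ⟨g, e, rfl⟩
  exact ⟨Sum.inl g, e, rfl⟩

/-- Placement-universality is monotone in the set of placements. [cite: BoykinMorPulverRoychowdhuryVatan1999] -/
theorem _root_.Literature.Computability.Cryptography.GeneratesDenselyModPhase.mono {N : ℕ} {S S' : Set (Matrix (Cryptography.QReg N) (Cryptography.QReg N) ℂ)}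
    (hSS' : S ⊆ S') (h : Cryptography.GeneratesDenselyModPhase N S) : Cryptography.GeneratesDenselyModPhase N S' := by
  unfold Cryptography.GeneratesDenselyModPhase at h ⊢
  refine h.mono ?_
  apply Subgroup.closure_mono
  rintro U (hU | hU)
  · exact Or.inl (hSS' hU)
  · exact Or.inr hU

/-- **Universality of `ajlGateSet` from that of Clifford+`T`** (it contains Clifford+`T`).
[cite: BoykinMorPulverRoychowdhuryVatan1999] -/
theorem ajlGateSet_isUniversal_of (h : Cryptography.cliffordT.IsUniversal) : ajlGateSet.IsUniversal := by
  obtain ⟨n₀, hn₀⟩ := h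
  exact ⟨n₀, fun N hN => (hn₀ N hN).mono (placements_cliffordT_subset N)⟩

/-! ### Unitarity of the AJL gates (Claims 2.2, 2.4–2.6 for the local generator) -/

section LocalUnitary

/-- Vertex codes lie in `{1, 2, 3, 4}`. [folklore] -/
theorem vertexOfBits_mem (a b : Bool) : 1 ≤ vertexOfBits a b ∧ vertexOfBits a b ≤ 4 := by
  cases a <;> cases b <;> simp [vertexOfBits]

/-- The vertex code is injective. [folklore] -/
theorem vertexOfBits_inj {a b a' b' : Bool} (h : vertexOfBits a b = vertexOfBits a' b') :
    a = a' ∧ b = b' := by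
  cases a <;> cases b <;> cases a' <;> cases b' <;> simp [vertexOfBits] at h ⊢

/-- The support condition of the `(q, p)` entry of `Φ_loc`. [cite: AharonovJonesLandau2009, §2.12] -/
def LocalSupport (q p : Cryptography.QReg 6) : Prop :=
  vertexOfBits (p 0) (p 1) = vertexOfBits (q 0) (q 1) ∧
    vertexOfBits (p 4) (p 5) = vertexOfBits (q 4) (q 5) ∧
    vertexOfBits (p 0) (p 1) = vertexOfBits (p 4) (p 5) ∧
    (vertexOfBits (p 2) (p 3) = vertexOfBits (p 0) (p 1) + 1 ∨
      vertexOfBits (p 2) (p 3) = vertexOfBits (p 0) (p 1) - 1) ∧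
    (vertexOfBits (q 2) (q 3) = vertexOfBits (p 0) (p 1) + 1 ∨
      vertexOfBits (q 2) (q 3) = vertexOfBits (p 0) (p 1) - 1)

/-- The support condition is decidable. [folklore] -/
instance (q p : Cryptography.QReg 6) : Decidable (LocalSupport q p) := by
  unfold LocalSupport; infer_instance

/-- Entry formula of `Φ_loc` (definitional). [cite: AharonovJonesLandau2009, §2.12] -/
theorem ajlLocalPhi_apply (q p : Cryptography.QReg 6) :
    ajlLocalPhi q p = if LocalSupport q p then
      Real.sqrt (ajlWeight 5 (vertexOfBits (p 2) (p 3)) * ajlWeight 5 (vertexOfBits (q 2) (q 3))) /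
        ajlWeight 5 (vertexOfBits (p 0) (p 1)) else 0 := rfl

namespace LocalSupport

variable {q p : Cryptography.QReg 6}

/-- On the support the outer registers of `q` and `p` agree bitwise. [folklore] -/
theorem outer (h : LocalSupport q p) : q 0 = p 0 ∧ q 1 = p 1 ∧ q 4 = p 4 ∧ q 5 = p 5 := by
  obtain ⟨h0, h1⟩ := vertexOfBits_inj h.1
  obtain ⟨h4, h5⟩ := vertexOfBits_inj h.2.1
  exact ⟨h0.symm, h1.symm, h4.symm, h5.symm⟩

/-- The support condition is symmetric. [cite: AharonovJonesLandau2009, Claim 2.5] -/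
theorem symm (h : LocalSupport q p) : LocalSupport p q := by
  obtain ⟨h1, h2, h3, h4, h5⟩ := h
  refine ⟨h1.symm, h2.symm, ?_, ?_, ?_⟩
  · rw [← h1, h3, h2]
  · rw [← h1]; exact h5
  · rw [← h1]; exact h4

end LocalSupport

/-- **Hermiticity of `Φ_loc`** (real symmetric). [cite: AharonovJonesLandau2009, Claim 2.5] -/
theorem ajlLocalPhi_transpose : ajlLocalPhiᵀ = ajlLocalPhi := by
  ext q p
  rw [transpose_apply, ajlLocalPhi_apply, ajlLocalPhi_apply]
  by_cases h : LocalSupport q p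
  · rw [if_pos h, if_pos h.symm, h.1, mul_comm]
  · rw [if_neg h, if_neg fun h' => h h'.symm]

/-- Replace the middle vertex register (wires `2, 3`) of `p` by `v`. [folklore] -/
def midSet (p : Cryptography.QReg 6) (v : Cryptography.QReg 2) : Cryptography.QReg 6 := fun t =>
  if t = 2 then v 0 else if t = 3 then v 1 else p t

/-- Bit `0` of `midSet`. [folklore] -/
@[simp] theorem midSet_zero (p : Cryptography.QReg 6) (v : Cryptography.QReg 2) : midSet p v 0 = p 0 := by simp [midSet]

/-- Bit `1` of `midSet`. [folklore] -/
@[simp] theorem midSet_one (p : Cryptography.QReg 6) (v : Cryptography.QReg 2) : midSet p v 1 = p 1 := by simp [midSet]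

/-- Bit `2` of `midSet`. [folklore] -/
@[simp] theorem midSet_two (p : Cryptography.QReg 6) (v : Cryptography.QReg 2) : midSet p v 2 = v 0 := by simp [midSet]

/-- Bit `3` of `midSet`. [folklore] -/
@[simp] theorem midSet_three (p : Cryptography.QReg 6) (v : Cryptography.QReg 2) : midSet p v 3 = v 1 := by simp [midSet]

/-- Bit `4` of `midSet`. [folklore] -/
@[simp] theorem midSet_four (p : Cryptography.QReg 6) (v : Cryptography.QReg 2) : midSet p v 4 = p 4 := by simp [midSet]

/-- Bit `5` of `midSet`. [folklore] -/
@[simp] theorem midSet_five (p : Cryptography.QReg 6) (v : Cryptography.QReg 2) : midSet p v 5 = p 5 := by simp [midSet]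

/-- `midSet p` is injective. [folklore] -/
theorem midSet_injective (p : Cryptography.QReg 6) : Function.Injective (midSet p) := by
  intro v v' h
  funext t
  have h2 := congr_fun h 2
  have h3 := congr_fun h 3
  simp only [midSet] at h2 h3
  simp at h2 h3
  fin_cases t
  · exact h2
  · exact h3

/-- A string in the support of column `p` of `Φ_loc` is `p` with a new middle register. [folklore] -/
theorem eq_midSet_of_localSupport {r p : Cryptography.QReg 6} (h : LocalSupport r p) :
    r = midSet p ![r 2, r 3] := by
  obtain ⟨h0, h1, h4, h5⟩ := h.outer
  funext t
  fin_cases t <;> simp [midSet, h0, h1, h4, h5]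

/-- The column-`p` entries of `Φ_loc` vanish off the range of `midSet p`. [folklore] -/
theorem ajlLocalPhi_apply_eq_zero_of_not_range {r p : Cryptography.QReg 6} (h : r ∉ Set.range (midSet p)) :
    ajlLocalPhi r p = 0 := by
  rw [ajlLocalPhi_apply, if_neg]
  exact fun hs => h ⟨_, (eq_midSet_of_localSupport hs).symm⟩

/-- The eigenvector identity summed over the four middle vertex codes:
`Σ_v [v = z ± 1] λ_v = λ_{z-1} + λ_{z+1}` for `z ∈ {1,…,4}` (`λ_0 = λ_5 = 0`).
[cite: AharonovJonesLandau2009, Claim 2.6] -/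
theorem sum_middle_weights {z : ℤ} (hz : 1 ≤ z ∧ z ≤ 4) :
    ∑ v : Cryptography.QReg 2, (if vertexOfBits (v 0) (v 1) = z + 1 ∨ vertexOfBits (v 0) (v 1) = z - 1 then
        ajlWeight 5 (vertexOfBits (v 0) (v 1)) else 0) = ajlWeight 5 (z - 1) + ajlWeight 5 (z + 1) := by
  have e := Fintype.sum_equiv (finTwoArrowEquiv Bool)
    (fun v : Cryptography.QReg 2 => if vertexOfBits (v 0) (v 1) = z + 1 ∨ vertexOfBits (v 0) (v 1) = z - 1 then
        ajlWeight 5 (vertexOfBits (v 0) (v 1)) else 0)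
    (fun ab : Bool × Bool => if vertexOfBits ab.1 ab.2 = z + 1 ∨ vertexOfBits ab.1 ab.2 = z - 1 then
        ajlWeight 5 (vertexOfBits ab.1 ab.2) else 0) (fun v => rfl)
  rw [e, Fintype.sum_prod_type]
  simp only [Fintype.sum_bool, vertexOfBits]
  have h0 : ajlWeight 5 0 = 0 := ajlWeight_of_not (by omega)
  have h5 : ajlWeight 5 5 = 0 := ajlWeight_of_not (by omega)
  obtain ⟨hz1, hz4⟩ := hz
  interval_cases z <;> norm_num [h0, h5] <;> ring

/-- **`Φ_loc² = d Φ_loc`**, `d = 2cos(π/5)` (Claim 2.4 for the local generator, from Claim 2.6).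
[cite: AharonovJonesLandau2009, Claims 2.4 and 2.6] -/
theorem ajlLocalPhi_mul_self : ajlLocalPhi * ajlLocalPhi = ajlLoopValue 5 • ajlLocalPhi := by
  ext q p
  rw [Matrix.mul_apply, Matrix.smul_apply, smul_eq_mul]
  -- restrict the sum to the four strings `midSet p v`
  have hsum : ∑ r, ajlLocalPhi q r * ajlLocalPhi r p =
      ∑ v : Cryptography.QReg 2, ajlLocalPhi q (midSet p v) * ajlLocalPhi (midSet p v) p := by
    have e : ∑ v : Cryptography.QReg 2, ajlLocalPhi q (midSet p v) * ajlLocalPhi (midSet p v) p =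
        ∑ r ∈ Finset.univ.map ⟨midSet p, midSet_injective p⟩, ajlLocalPhi q r * ajlLocalPhi r p :=
      (Finset.sum_map Finset.univ ⟨midSet p, midSet_injective p⟩
        (fun r => ajlLocalPhi q r * ajlLocalPhi r p)).symm
    rw [e]
    symm
    apply Finset.sum_subset (Finset.subset_univ _)
    intro r _ hr
    have h0 : ajlLocalPhi r p = 0 := ajlLocalPhi_apply_eq_zero_of_not_range fun ⟨v, hv⟩ =>
      hr (Finset.mem_map.2 ⟨v, Finset.mem_univ _, hv⟩)
    rw [h0, mul_zero]
  rw [hsum]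
  by_cases h : LocalSupport q p
  · -- on the support: every term is `[b_v = z ± 1] λ_{b_v} · S / λ_z²`
    set z := vertexOfBits (p 0) (p 1) with hz
    set S := Real.sqrt (ajlWeight 5 (vertexOfBits (p 2) (p 3)) * ajlWeight 5 (vertexOfBits (q 2) (q 3)))
      with hS
    obtain ⟨hq0, hq1, hq4, hq5⟩ := h.outer
    have hterm : ∀ v : Cryptography.QReg 2, ajlLocalPhi q (midSet p v) * ajlLocalPhi (midSet p v) p =
        (if vertexOfBits (v 0) (v 1) = z + 1 ∨ vertexOfBits (v 0) (v 1) = z - 1 then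
          ajlWeight 5 (vertexOfBits (v 0) (v 1)) else 0) * S / ajlWeight 5 z ^ 2 := by
      intro v
      by_cases hv : vertexOfBits (v 0) (v 1) = z + 1 ∨ vertexOfBits (v 0) (v 1) = z - 1
      · have h1 : LocalSupport (midSet p v) p :=
          ⟨by simp, by simp, h.2.2.1, h.2.2.2.1, by simpa [← hz] using hv⟩
        have h2 : LocalSupport q (midSet p v) :=
          ⟨by simp [hq0, hq1], by simp [hq4, hq5], by simpa using h.2.2.1, by simpa [← hz] using hv,
            by simpa [← hz] using h.2.2.2.2⟩
        rw [ajlLocalPhi_apply, if_pos h2, ajlLocalPhi_apply, if_pos h1, if_pos hv]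
        simp only [midSet_zero, midSet_one, midSet_two, midSet_three, ← hz]
        have ha := ajlWeight_nonneg 5 (vertexOfBits (v 0) (v 1))
        have hb := ajlWeight_nonneg 5 (vertexOfBits (p 2) (p 3))
        have hc := ajlWeight_nonneg 5 (vertexOfBits (q 2) (q 3))
        rw [div_mul_div_comm, ← sq, ← Real.sqrt_mul (mul_nonneg ha hc),
          show ajlWeight 5 (vertexOfBits (v 0) (v 1)) * ajlWeight 5 (vertexOfBits (q 2) (q 3)) *
              (ajlWeight 5 (vertexOfBits (p 2) (p 3)) * ajlWeight 5 (vertexOfBits (v 0) (v 1))) =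
            ajlWeight 5 (vertexOfBits (v 0) (v 1)) ^ 2 *
              (ajlWeight 5 (vertexOfBits (p 2) (p 3)) * ajlWeight 5 (vertexOfBits (q 2) (q 3))) by ring,
          Real.sqrt_mul (sq_nonneg _), Real.sqrt_sq ha, hS]
      · rw [if_neg hv, zero_mul, zero_div, ajlLocalPhi_apply, if_neg, zero_mul]
        intro h1
        exact hv (by simpa [← hz] using h1.2.2.2.1)
    simp_rw [hterm]
    rw [← Finset.sum_div, ← Finset.sum_mul, sum_middle_weights (vertexOfBits_mem _ _),
      ajlLocalPhi_apply, if_pos h, ← hS, ← hz]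
    have hz' : 1 ≤ z ∧ z + 1 ≤ ((5 : ℕ) : ℤ) := by
      have := vertexOfBits_mem (p 0) (p 1); rw [← hz] at this; omega
    rw [ajlWeight_pred_add_succ hz']
    have hpos := ajlWeight_pos hz'
    field_simp
  · rw [ajlLocalPhi_apply q p, if_neg h, mul_zero]
    refine Finset.sum_eq_zero fun v _ => ?_
    by_cases hp : LocalSupport (midSet p v) p
    · by_cases hq : LocalSupport q (midSet p v)
      · refine absurd ?_ h
        obtain ⟨a1, a2, a3, a4, a5⟩ := hp
        obtain ⟨b1, b2, b3, b4, b5⟩ := hq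
        exact ⟨a1.trans b1, a2.trans b2, a3, a4, by rw [a1]; exact b5⟩
      · rw [ajlLocalPhi_apply q, if_neg hq, zero_mul]
    · rw [ajlLocalPhi_apply _ p, if_neg hp, mul_zero]

/-- `Φ_loc` as a complex matrix is Hermitian. [cite: AharonovJonesLandau2009, Claim 2.5] -/
theorem ajlLocalPhi_map_conjTranspose :
    (ajlLocalPhi.map ((↑) : ℝ → ℂ))ᴴ = ajlLocalPhi.map ((↑) : ℝ → ℂ) := by
  ext q p
  have e : ajlLocalPhi p q = ajlLocalPhi q p := by
    rw [← transpose_apply ajlLocalPhi q p, ajlLocalPhi_transpose]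
  change star ((ajlLocalPhi p q : ℝ) : ℂ) = ((ajlLocalPhi q p : ℝ) : ℂ)
  rw [Complex.star_def, Complex.conj_ofReal, e]

/-- `Φ_loc² = dΦ_loc` over `ℂ`. [cite: AharonovJonesLandau2009, Claim 2.4] -/
theorem ajlLocalPhi_map_mul_self :
    ajlLocalPhi.map ((↑) : ℝ → ℂ) * ajlLocalPhi.map ((↑) : ℝ → ℂ) =
      (ajlLoopValue 5 : ℂ) • ajlLocalPhi.map ((↑) : ℝ → ℂ) := by
  ext q p
  have := congr_fun (congr_fun ajlLocalPhi_mul_self q) p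
  rw [Matrix.mul_apply, Matrix.smul_apply, smul_eq_mul] at this
  simp only [Matrix.mul_apply, Matrix.map_apply, Matrix.smul_apply, smul_eq_mul]
  exact_mod_cast this

/-- **The local crossing unitaries are unitary** (Claim 2.2). [cite: AharonovJonesLandau2009, Claim 2.2] -/
theorem ajlLocalCrossing_mem_unitaryGroup (positive : Bool) :
    ajlLocalCrossing positive ∈ Matrix.unitaryGroup (Cryptography.QReg 6) ℂ :=
  crossing_mem_unitaryGroup_of_sq 5 ajlLocalPhi_map_conjTranspose ajlLocalPhi_map_mul_self positive

/-- Entries of a controlled gate against `Fin.cons`-presented strings. [folklore] -/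
theorem controlledGate_apply_cons {m : ℕ} (U : Matrix (Cryptography.QReg m) (Cryptography.QReg m) ℂ) (a b : Bool)
    (s t : Cryptography.QReg m) :
    controlledGate U (Fin.cons a s) (Fin.cons b t) =
      if a = b then (if b = true then U s t else if s = t then 1 else 0) else 0 := by
  simp [controlledGate, Fin.tail_cons, Fin.cons_zero]

/-- **A controlled unitary is unitary.** (Nielsen–Chuang §4.3.) [folklore] -/
theorem controlledGate_mem_unitaryGroup {m : ℕ} {U : Matrix (Cryptography.QReg m) (Cryptography.QReg m) ℂ}
    (hU : U ∈ Matrix.unitaryGroup (Cryptography.QReg m) ℂ) :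
    controlledGate U ∈ Matrix.unitaryGroup (Cryptography.QReg (m + 1)) ℂ := by
  rw [Matrix.mem_unitaryGroup_iff] at hU ⊢
  change U * Uᴴ = 1 at hU
  change controlledGate U * (controlledGate U)ᴴ = 1
  ext q p
  -- present `q`, `p` and the summation variable as `Fin.cons`
  obtain ⟨a, s, rfl⟩ : ∃ a s, q = Fin.cons a s := ⟨q 0, Fin.tail q, (Fin.cons_self_tail q).symm⟩
  obtain ⟨b, t, rfl⟩ : ∃ b t, p = Fin.cons b t := ⟨p 0, Fin.tail p, (Fin.cons_self_tail p).symm⟩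
  have hsplit : ∑ j, controlledGate U (Fin.cons a s) j * (controlledGate U)ᴴ j (Fin.cons b t) =
      ∑ cr : Bool × Cryptography.QReg m, controlledGate U (Fin.cons a s) (Fin.cons cr.1 cr.2) *
        (controlledGate U)ᴴ (Fin.cons cr.1 cr.2) (Fin.cons b t) :=
    (Fintype.sum_equiv (Fin.consEquiv fun _ => Bool) _ _ (fun cr => rfl)).symm
  rw [Matrix.mul_apply, hsplit, Fintype.sum_prod_type]
  simp only [Fintype.sum_bool, conjTranspose_apply, controlledGate_apply_cons]
  have hUst : ∀ s t : Cryptography.QReg m, ∑ r, U s r * starRingEnd ℂ (U t r) = if s = t then 1 else 0 := by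
    intro s t
    have := congr_fun (congr_fun hU s) t
    rw [Matrix.mul_apply, Matrix.one_apply] at this
    simpa [conjTranspose_apply] using this
  have hcons : ((Fin.cons a s : Cryptography.QReg (m + 1)) = Fin.cons b t) ↔ a = b ∧ s = t := Fin.cons_inj
  rw [Matrix.one_apply]
  cases a <;> cases b <;> simp [hUst, hcons, Finset.sum_ite_eq, eq_comm]

/-- **The AJL gate set is unitary** (Clifford+`T`: Nielsen–Chuang §4.5.3, discharged in the tree as
`cliffordT_isUnitary_holds`; the controlled crossings by Claim 2.2). [cite: AharonovJonesLandau2009, Claim 2.2] -/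
theorem ajlGateSet_isUnitary_of (h : Cryptography.cliffordT.IsUnitary) : ajlGateSet.IsUnitary := by
  rintro (g | positive)
  · exact h g
  · exact controlledGate_mem_unitaryGroup (ajlLocalCrossing_mem_unitaryGroup positive)

end LocalUnitary

/-! ### Inverse-closedness of the AJL gate set (the gate identities) -/

section InverseClosed

/-- The `T` gate is the diagonal matrix `diag(1, ω)`; now `tGate_eq_diagonal_omega` of
`CliffordTInverse.lean` (dedup, promote event 188969). [cite: NielsenChuang2010, §4.2] -/
@[deprecated tGate_eq_diagonal_omega (since := "2026-08-15")]
alias tGate_eq_diagonal := tGate_eq_diagonal_omega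

/-- `S⁴ = 1`; now `sGate_pow_four_eq_one` of `CliffordTInverse.lean` (dedup, promote event 188969).
[cite: NielsenChuang2010, §4.2] -/
@[deprecated sGate_pow_four_eq_one (since := "2026-08-15")]
alias sGate_pow_four := sGate_pow_four_eq_one

/-- `T⁸ = 1`; now `tGate_pow_eight_eq_one` of `CliffordTInverse.lean` (dedup, promote event 188969).
[cite: NielsenChuang2010, §4.2] -/
@[deprecated tGate_pow_eight_eq_one (since := "2026-08-15")]
alias tGate_pow_eight := tGate_pow_eight_eq_one

/-- `CNOT² = 1`; now `cnot_mul_self` of `CliffordTInverse.lean` (dedup, promote event 188969).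
[cite: NielsenChuang2010, §4.3] -/
@[deprecated cnot_mul_self (since := "2026-08-15")]
alias cnot_mul_cnot := cnot_mul_self

/-- Entrywise formula for the product of two controlled gates: block multiplication.
(Nielsen–Chuang §4.3.) [folklore] -/
theorem controlledGate_mul {m : ℕ} (U V : Matrix (Cryptography.QReg m) (Cryptography.QReg m) ℂ) :
    controlledGate U * controlledGate V = controlledGate (U * V) := by
  ext q p
  obtain ⟨a, s, rfl⟩ : ∃ a s, q = Fin.cons a s := ⟨q 0, Fin.tail q, (Fin.cons_self_tail q).symm⟩
  obtain ⟨b, t, rfl⟩ : ∃ b t, p = Fin.cons b t := ⟨p 0, Fin.tail p, (Fin.cons_self_tail p).symm⟩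
  have hsplit : ∑ j, controlledGate U (Fin.cons a s) j * controlledGate V j (Fin.cons b t) =
      ∑ cr : Bool × Cryptography.QReg m, controlledGate U (Fin.cons a s) (Fin.cons cr.1 cr.2) *
        controlledGate V (Fin.cons cr.1 cr.2) (Fin.cons b t) :=
    (Fintype.sum_equiv (Fin.consEquiv fun _ => Bool) _ _ (fun cr => rfl)).symm
  rw [Matrix.mul_apply, hsplit, Fintype.sum_prod_type]
  simp only [Fintype.sum_bool, controlledGate_apply_cons, Matrix.mul_apply]
  cases a <;> cases b <;> simp [Finset.sum_ite_eq']

/-- The controlled identity is the identity. [folklore] -/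
theorem controlledGate_one {m : ℕ} : controlledGate (1 : Matrix (Cryptography.QReg m) (Cryptography.QReg m) ℂ) = 1 := by
  ext q p
  obtain ⟨a, s, rfl⟩ : ∃ a s, q = Fin.cons a s := ⟨q 0, Fin.tail q, (Fin.cons_self_tail q).symm⟩
  obtain ⟨b, t, rfl⟩ : ∃ b t, p = Fin.cons b t := ⟨p 0, Fin.tail p, (Fin.cons_self_tail p).symm⟩
  rw [controlledGate_apply_cons, Matrix.one_apply, Matrix.one_apply]
  have hcons : ((Fin.cons a s : Cryptography.QReg (m + 1)) = Fin.cons b t) ↔ a = b ∧ s = t := Fin.cons_inj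
  cases a <;> cases b <;> simp [hcons]

/-- **The two local crossing gates are inverse to each other**: `ρ_A(σ^{∓1}) ρ_A(σ^{±1}) = 1`
(`(c⁻¹Φ + c1)(cΦ + c⁻¹1) = (d + c² + c⁻²)Φ + 1 = 1` for `c ∈ {A, A⁻¹}`, `d = -A² - A⁻²`).
[cite: AharonovJonesLandau2009, Claim 2.1 (ρ_A is a representation of `B_n`)] -/
theorem ajlLocalCrossing_not_mul (positive : Bool) :
    ajlLocalCrossing (!positive) * ajlLocalCrossing positive = 1 := by
  have hd : (ajlLoopValue 5 : ℂ) = -ajlPoint 5 ^ 2 - (ajlPoint 5)⁻¹ ^ 2 := by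
    rw [← loopValue_ajlPoint]; rfl
  have hA0 : ajlPoint 5 ≠ 0 := ajlPoint_ne_zero 5
  have key : ∀ c : ℂ, c ≠ 0 → (ajlLoopValue 5 : ℂ) + c ^ 2 + c⁻¹ ^ 2 = 0 →
      (c⁻¹ • ajlLocalPhi.map ((↑) : ℝ → ℂ) + c • (1 : Matrix (Cryptography.QReg 6) (Cryptography.QReg 6) ℂ)) *
        (c • ajlLocalPhi.map ((↑) : ℝ → ℂ) + c⁻¹ • (1 : Matrix (Cryptography.QReg 6) (Cryptography.QReg 6) ℂ)) = 1 := by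
    intro c hc hdc
    rw [add_mul, mul_add, mul_add]
    simp only [Matrix.smul_mul, Matrix.mul_smul, Matrix.one_mul, Matrix.mul_one, smul_smul,
      ajlLocalPhi_map_mul_self]
    rw [← add_assoc, ← add_smul, ← add_smul, inv_mul_cancel₀ hc, one_smul]
    have e0 : c * (c⁻¹ * (ajlLoopValue 5 : ℂ)) = ajlLoopValue 5 := by
      rw [← mul_assoc, mul_inv_cancel₀ hc, one_mul]
    have : c * (c⁻¹ * (ajlLoopValue 5 : ℂ)) + c⁻¹ * c⁻¹ + c * c = 0 := by
      rw [e0]; linear_combination hdc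
    rw [this, zero_smul, zero_add]
  cases positive
  · -- `(!false) = true`: `(AΦ + A⁻¹1)(A⁻¹Φ + A1)`, i.e. `c = A⁻¹`
    simp only [Bool.not_false, ajlLocalCrossing, crossingWeight_true, crossingWeight_false, if_true]
    have := key (ajlPoint 5)⁻¹ (inv_ne_zero hA0) (by rw [inv_inv, hd]; ring)
    rwa [inv_inv] at this
  · simp only [Bool.not_true, ajlLocalCrossing, crossingWeight_true, crossingWeight_false, if_true]
    exact key (ajlPoint 5) hA0 (by rw [hd]; ring)

/-- The two controlled crossing gates are inverse to each other. [cite: AharonovJonesLandau2009, Claim 2.1] -/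
theorem ajlCrossingGate_not_mul (positive : Bool) :
    ajlCrossingGate (!positive) * ajlCrossingGate positive = 1 := by
  rw [ajlCrossingGate, ajlCrossingGate, controlledGate_mul, ajlLocalCrossing_not_mul, controlledGate_one]

/-- Placement commutes with powers; now `placeGate_pow_eq_pow` of `CliffordTInverse.lean` (dedup,
promote event 188969). [cite: NielsenChuang2010, §4.2] -/
@[deprecated placeGate_pow_eq_pow (since := "2026-08-15")]
alias placeGate_pow := placeGate_pow_eq_pow

/-- **`ajlGateSet` is inverse-closed**: `H⁻¹ = H`, `S⁻¹ = S³`, `T⁻¹ = T⁷`, `CNOT⁻¹ = CNOT`, and the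
inverse of a controlled crossing gate is the controlled crossing gate of the opposite sign.
[cite: DawsonNielsen2006, §2 (gate sets closed under inverses)] [cite: AharonovJonesLandau2009, Claim 2.1] -/
theorem ajlGateSet_isInverseClosed : ajlGateSet.IsInverseClosed := by
  rintro N Mx ⟨g, e, rfl⟩
  rcases g with g | positive
  · -- Clifford+`T` gates
    cases g
    · -- `H`
      change Fin 1 ↪ Fin N at e
      refine ⟨[Cryptography.placeGate e Cryptography.hGate], by simp [Cryptography.placements]; exact ⟨Sum.inl Cryptography.CliffordTOp.H, e, rfl⟩, ?_⟩
      show [Cryptography.placeGate e Cryptography.hGate].prod * Cryptography.placeGate e Cryptography.hGate = 1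
      rw [List.prod_singleton, ← Cryptography.placeGate_mul_holds e, Literature.Computability.QuantumComplexity.hGate_mul_hGate, Cryptography.placeGate_one]
    · -- `S`
      change Fin 1 ↪ Fin N at e
      refine ⟨List.replicate 3 (Cryptography.placeGate e Cryptography.sGate), fun P hP => ?_, ?_⟩
      · rw [List.eq_of_mem_replicate hP]; exact ⟨Sum.inl Cryptography.CliffordTOp.S, e, rfl⟩
      · show (List.replicate 3 (Cryptography.placeGate e Cryptography.sGate)).prod * Cryptography.placeGate e Cryptography.sGate = 1
        rw [List.prod_replicate, ← pow_succ, ← placeGate_pow_eq_pow, sGate_pow_four_eq_one, Cryptography.placeGate_one]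
    · -- `T`
      change Fin 1 ↪ Fin N at e
      refine ⟨List.replicate 7 (Cryptography.placeGate e Cryptography.tGate), fun P hP => ?_, ?_⟩
      · rw [List.eq_of_mem_replicate hP]; exact ⟨Sum.inl Cryptography.CliffordTOp.T, e, rfl⟩
      · show (List.replicate 7 (Cryptography.placeGate e Cryptography.tGate)).prod * Cryptography.placeGate e Cryptography.tGate = 1
        rw [List.prod_replicate, ← pow_succ, ← placeGate_pow_eq_pow, tGate_pow_eight_eq_one, Cryptography.placeGate_one]
    · -- `CNOT`
      change Fin 2 ↪ Fin N at e
      refine ⟨[Cryptography.placeGate e Cryptography.cnot], by simp [Cryptography.placements]; exact ⟨Sum.inl Cryptography.CliffordTOp.CNOT, e, rfl⟩, ?_⟩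
      show [Cryptography.placeGate e Cryptography.cnot].prod * Cryptography.placeGate e Cryptography.cnot = 1
      rw [List.prod_singleton, ← Cryptography.placeGate_mul_holds e, cnot_mul_self, Cryptography.placeGate_one]
  · -- controlled crossing gates
    change Fin 7 ↪ Fin N at e
    refine ⟨[Cryptography.placeGate e (ajlCrossingGate (!positive))], by simp [Cryptography.placements]; exact ⟨Sum.inr (!positive), e, rfl⟩, ?_⟩
    show [Cryptography.placeGate e (ajlCrossingGate (!positive))].prod * Cryptography.placeGate e (ajlCrossingGate positive) = 1
    rw [List.prod_singleton, ← Cryptography.placeGate_mul_holds e, ajlCrossingGate_not_mul, Cryptography.placeGate_one]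

end InverseClosed

/-! ### Assembly -/

/-- **Assembly of the decomposition.** Gate-set independence of `PromiseBQP` (Solovay–Kitaev;
Bernstein–Vazirani, Dawson–Nielsen), AJL's theorem over the finite gate set `ajlGateSet`, and the
four hypotheses on that gate set give `ajl_jonesApproxProblem_mem_PromiseBQP`.
[cite: AharonovJonesLandau2009, Thm. 1.2 and §3] -/
theorem ajl_jonesApproxProblem_mem_PromiseBQP_of_steps (hSK : PromiseBQPOver_eq_PromiseBQP)
    (hAJL : ajl_mem_PromiseBQPOver_ajlGateSet) (hU : ajlGateSet.IsUnitary)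
    (huniv : ajlGateSet.IsUniversal) (hinv : ajlGateSet.IsInverseClosed)
    (hcomp : ajlGateSet_polyTimeEntries) : ajl_jonesApproxProblem_mem_PromiseBQP := by
  have h := hSK ajlGateSet hU huniv hinv hcomp
  rw [ajl_jonesApproxProblem_mem_PromiseBQP, ← h]
  exact hAJL

/-- **The decomposition, with everything about `ajlGateSet` discharged except universality of
Clifford+`T`** (`Literature.Computability.QuantumComplexity.cliffordT_isUniversal`, Boykin et al. 1999, a named fact of
`BQP.lean`) and the polynomial-time computability of the entries: `ajl_jonesApproxProblem_mem_PromiseBQP`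
follows from gate-set independence of `PromiseBQP` (S1), AJL's theorem over `ajlGateSet` (S2),
universality of Clifford+`T`, and S3. [cite: AharonovJonesLandau2009, Thm. 1.2 and §3] -/
theorem ajl_jonesApproxProblem_mem_PromiseBQP_of_steps' (hSK : PromiseBQPOver_eq_PromiseBQP)
    (hAJL : ajl_mem_PromiseBQPOver_ajlGateSet) (huniv : Cryptography.cliffordT.IsUniversal)
    (hcomp : ajlGateSet_polyTimeEntries) : ajl_jonesApproxProblem_mem_PromiseBQP :=
  ajl_jonesApproxProblem_mem_PromiseBQP_of_steps hSK hAJL (ajlGateSet_isUnitary_of Cryptography.cliffordT_isUnitary_holds)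
    (ajlGateSet_isUniversal_of huniv) ajlGateSet_isInverseClosed hcomp

end Literature.Computability.QuantumComplexity

end
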